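import Mathlib
import Summits.ValiantsHypothesis.ValiantsHypothesis.Theorems.BarrierLeverPartitionMinorsHitByVPHiddenStatesBall
import Summits.ValiantsHypothesis.ValiantsHypothesis.Theorems.BarrierLeverPartitionMinorsHitByVPBinaryContiguous

/-!
# Route BarrierLever — item `PartitionMinorsHitByVP` (stmt-ValiantsHypothesis-19717):
# Conjecture Q\* holds on the binary-contiguous class

Helper file (`--supports stmt-ValiantsHypothesis-19717`; cell valiant-natproofs, rung V4, 𝒟-side of door (c); prover seat
val-np-p3 gen 6). Definition-free. Closes NO item.

`HiddenStates.BallGood h K r u` (file `…HiddenStatesBall`) is the cell's Conjecture Q\* for the column family `u`: the additive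
matrix of `u` against the ball–colex hidden family is nonsingular for some table. Here the ROWS of that additive matrix are the
hidden family and the COLUMNS are `u` — so val-np-p1 g10's Frobenius theorem (`exists_table_of_binaryContiguous`: arbitrary
injective rows × BINARY-CONTIGUOUS columns) applies verbatim with rows := the ball enumeration:

* **`ballGood_of_binaryContiguous`** — if `Σ_{c ∈ u j ∖ Z} 2^{e c} = σ j` for a neutral set `Z`, binary weights `e` and a
  permutation `σ` of `Fin r` (faces `2^T`, faces with extra elements of matching weight, digit-with-carry mixtures, …), then
  `BallGood h h r u`. So Q\* holds on the whole binary-contiguous class, for every `r` and `h`.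

WHAT THIS IS NOT: as a CLASS of layouts this gives nothing beyond `partitionMinor_hit_of_binaryContiguous` (which needs contiguity
on one side only); it is a certified sub-case of the conjecture that carries item 19717. Nothing on 14610 or VP vs VNP.
-/

set_option linter.dupNamespace false

namespace Summit.ValiantsHypothesis.ValiantsHypothesis.Theorems.BarrierLever.HiddenStates

open Finset Matrix

noncomputable section

/-- **Q\* on the binary-contiguous class.** A column family whose binary weights modulo a neutral set are exactly
`0, …, r−1` is `BallGood h h r` (by val-np-p1's Frobenius theorem with rows := the ball–colex hidden family). -/
theorem ballGood_of_binaryContiguous (h r : ℕ) (u : Fin r → Finset (Fin h)) (Z : Finset (Fin h)) (wexp : Fin h → ℕ)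
    (σ : Equiv.Perm (Fin r)) (hw : ∀ j, ∑ c ∈ u j \ Z, 2 ^ wexp c = (σ j : ℕ)) : BallGood h h r u := by
  intro e he _hthr
  obtain ⟨ω₀, ω, hdet⟩ := SubsetSum.exists_table_of_binaryContiguous e u he Z wexp σ hw
  refine ⟨fun o a => Option.elim o (ω₀ a) (fun q => ω q a), ?_⟩
  have hM : (Matrix.of fun i k : Fin r =>
      ∏ a ∈ u i, ((fun o a => Option.elim o (ω₀ a) (fun q => ω q a)) none a +
        ∑ q ∈ e k, (fun o a => Option.elim o (ω₀ a) (fun q => ω q a)) (some q) a)) =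
      (Matrix.of fun k i : Fin r => ∏ c ∈ u i, (ω₀ c + ∑ a ∈ e k, ω a c))ᵀ := by
    refine Matrix.ext fun i k => ?_
    simp only [Matrix.of_apply, Matrix.transpose_apply, Option.elim]
  rw [hM, Matrix.det_transpose]
  exact hdet

end

end Summit.ValiantsHypothesis.ValiantsHypothesis.Theorems.BarrierLever.HiddenStates
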